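import Summits.KontsevichZagierPeriods.KontsevichZagierPeriods.Theorems.TerasomaMultiplicationMultiplicationAccessibleCornerGraphRepsGen
import Literature.NumberTheory.Transcendental.KZProductIdeal
import Literature.NumberTheory.Transcendental.KZTorusLogRep

/-!
# `MultiplicationAccessible` (stmt-KontsevichZagierPeriods-12305), line `shifted-family-prime-sieve`:
geometry of the lateral Newton–Leibniz moves of the corner Stokes in general dimension (`cornerThetaGeoGen`)

Dimension `p = n + 2`, coordinates `w = (θ_1, …, θ_{n+1}, y, v) ∈ ℝ^(n+3)`. For the `θ_k`-direction move the moving coordinate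
`θ_k` is put LAST by the transposition `e = (θ_k v)` of the coordinate indices (`z = w ∘ e`: `v` in slot `k`, `θ_k` last).
Over the base `B = {q = (θ_{i≠k}, v, y)}` the `θ_k`-fibre of the open chart domain `W` is `(a q, b q)`,
`a = max 0 (1 − Σ_{i≠k}θ_i − 1/y)`, `b = min (1 − Σ_{i≠k}θ_i) (1/y)`; the closed band `{a ≤ θ_k ≤ b}` is the given `Wc` read
through `e`. For an abstract primitive `c` (semialgebraic on `Wc`, continuous on the closed fibres, vanishing at their ends)
with bounded semialgebraic slice derivative `d` on `W`, ONE rule-3 move (`KZ.exists_band_newtonLeibniz`) gives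
`[band, d ∘ e] ∼ [B, 0] ∼ 0`; opening the fibres (`KZ.of_sub_of_restrict_openBand_mem_relations`) and permuting the coordinates
back (`KZ.of_sub_of_reindex_mem_relations`) yields `N = [W, d]`, `[N] ∈ KZ.relations`. The case `p = 3`, `k = 0` is
`cornerStokesTheta1`. References: Kontsevich–Zagier 2001 §1.2 rule (3).
-/

noncomputable section

open MeasureTheory Set Real
open scoped BigOperators
open Literature.NumberTheory.Transcendental
open Literature.NumberTheory.Transcendental.KZ
open Literature.ModelTheory.ExponentialFields (IsSemialgebraic isSemialgebraic_setOf_eval_pos isSemialgebraic_setOf_eval_lt)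
open MvPolynomial (X)

namespace Summit.KontsevichZagierPeriods.TerasomaMultiplication.MultiplicationAccessible

namespace CornerThetaGeo

variable {n : ℕ} {k : Fin (n + 1)}

/-- The transposition `θ_k ↔ v` fixes `θ_i`, `i ≠ k`. [folklore] -/
theorem swap_cc {i : Fin (n + 1)} (h : i ≠ k) :
    Equiv.swap (Fin.castSucc (Fin.castSucc k) : Fin (n + 3)) (Fin.last (n + 2)) (Fin.castSucc (Fin.castSucc i)) = Fin.castSucc (Fin.castSucc i) :=
  Equiv.swap_apply_of_ne_of_ne (fun h' => h (Fin.castSucc_injective _ (Fin.castSucc_injective _ h'))) (Fin.castSucc_lt_last _).ne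

/-- The transposition `θ_k ↔ v` fixes `y`. [folklore] -/
theorem swap_yy (k : Fin (n + 1)) :
    Equiv.swap (Fin.castSucc (Fin.castSucc k) : Fin (n + 3)) (Fin.last (n + 2)) (Fin.castSucc (Fin.last (n + 1))) = Fin.castSucc (Fin.last (n + 1)) :=
  Equiv.swap_apply_of_ne_of_ne (fun h' => (Fin.castSucc_lt_last k).ne' (Fin.castSucc_injective _ h')) (Fin.castSucc_lt_last _).ne

/-- The partial sum `Σ_{i ≠ k}` does not see the transposition `θ_k ↔ v`. [folklore] -/
theorem sum_erase_swap (k : Fin (n + 1)) (w : Fin (n + 3) → ℝ) :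
    ∑ i ∈ Finset.univ.erase k, w (Equiv.swap (Fin.castSucc (Fin.castSucc k) : Fin (n + 3)) (Fin.last (n + 2))
      (Fin.castSucc (Fin.castSucc i))) = ∑ i ∈ Finset.univ.erase k, w (Fin.castSucc (Fin.castSucc i)) :=
  Finset.sum_congr rfl fun i hi => by rw [swap_cc (Finset.ne_of_mem_erase hi)]

/-- A sum over `Fin (n+1)` split at `k`. [folklore] -/
theorem sum_eq_add_sum_erase (k : Fin (n + 1)) (θ : Fin (n + 1) → ℝ) : ∑ i, θ i = θ k + ∑ i ∈ Finset.univ.erase k, θ i :=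
  (Finset.add_sum_erase Finset.univ θ (Finset.mem_univ k)).symm

variable {e : Equiv.Perm (Fin (n + 3))} (he : e = Equiv.swap (Fin.castSucc (Fin.castSucc k)) (Fin.last (n + 2)))
  {B : Set (Fin (n + 2) → ℝ)}
  (hB : B = {q : Fin (n + 2) → ℝ | (∀ i : Fin (n + 1), i ≠ k → 0 < q (Fin.castSucc i)) ∧ ∑ i ∈ Finset.univ.erase k, q (Fin.castSucc i) < 1 ∧ 0 < q (Fin.last (n + 1)) ∧ q (Fin.last (n + 1)) * (1 - ∑ i ∈ Finset.univ.erase k, q (Fin.castSucc i)) < 2 ∧ (∀ i : Fin (n + 1), i ≠ k → q (Fin.last (n + 1)) * q (Fin.castSucc i) < 1) ∧ 0 < q (Fin.castSucc k) ∧ q (Fin.castSucc k) < 1})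
  {a b : (Fin (n + 2) → ℝ) → ℝ}
  (ha : ∀ q, a q = max 0 (1 - ∑ i ∈ Finset.univ.erase k, q (Fin.castSucc i) - (q (Fin.last (n + 1)))⁻¹))
  (hb : ∀ q, b q = min (1 - ∑ i ∈ Finset.univ.erase k, q (Fin.castSucc i)) (q (Fin.last (n + 1)))⁻¹)
  {Wc Wo : Set (Fin (n + 3) → ℝ)}
  (hWc : Wc = {w : Fin (n + 3) → ℝ | (∀ i : Fin (n + 1), i ≠ k → 0 < w (Fin.castSucc (Fin.castSucc i))) ∧ ∑ i ∈ Finset.univ.erase k, w (Fin.castSucc (Fin.castSucc i)) < 1 ∧ 0 < w (Fin.castSucc (Fin.last (n + 1))) ∧ w (Fin.castSucc (Fin.last (n + 1))) * (1 - ∑ i ∈ Finset.univ.erase k, w (Fin.castSucc (Fin.castSucc i))) < 2 ∧ (∀ i : Fin (n + 1), i ≠ k → w (Fin.castSucc (Fin.last (n + 1))) * w (Fin.castSucc (Fin.castSucc i)) < 1) ∧ 0 < w (Fin.last (n + 2)) ∧ w (Fin.last (n + 2)) < 1 ∧ 0 ≤ w (Fin.castSucc (Fin.castSucc k)) ∧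 ∑ i : Fin (n + 1), w (Fin.castSucc (Fin.castSucc i)) ≤ 1 ∧ w (Fin.castSucc (Fin.last (n + 1))) * (1 - ∑ i : Fin (n + 1), w (Fin.castSucc (Fin.castSucc i))) ≤ 1 ∧ w (Fin.castSucc (Fin.last (n + 1))) * w (Fin.castSucc (Fin.castSucc k)) ≤ 1})
  (hWo : Wo = {w : Fin (n + 3) → ℝ | (Fin.init w : Fin (n + 2) → ℝ) ∈ {u : Fin (n + 2) → ℝ | (∀ i : Fin (n + 1), 0 < u (Fin.castSucc i)) ∧ ∑ i : Fin (n + 1), u (Fin.castSucc i) < 1 ∧ 0 < u (Fin.last (n + 1)) ∧ u (Fin.last (n + 1)) * (1 - ∑ i : Fin (n + 1), u (Fin.castSucc i)) < 1 ∧ ∀ i : Fin (n + 1), u (Fin.last (n + 1)) * u (Fin.castSucc i) < 1} ∧ 0 < w (Fin.last (n + 2)) ∧ w (Fin.last (n + 2)) < 1})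

include he in
/-- Coordinates of the permuted fibre point `(snoc q t) ∘ e`: `θ_i = q_i` (`i ≠ k`), `θ_k = t`, `y = q_last`, `v = q_k`,
and `Σ_i θ_i = t + Σ_{i ≠ k} q_i`. [folklore] -/
theorem pt_apply (q : Fin (n + 2) → ℝ) (t : ℝ) :
    (∀ i : Fin (n + 1), i ≠ k → (Fin.snoc q t : Fin (n + 3) → ℝ) (e (Fin.castSucc (Fin.castSucc i))) = q (Fin.castSucc i)) ∧
    (Fin.snoc q t : Fin (n + 3) → ℝ) (e (Fin.castSucc (Fin.castSucc k))) = t ∧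
    (Fin.snoc q t : Fin (n + 3) → ℝ) (e (Fin.castSucc (Fin.last (n + 1)))) = q (Fin.last (n + 1)) ∧
    (Fin.snoc q t : Fin (n + 3) → ℝ) (e (Fin.last (n + 2))) = q (Fin.castSucc k) ∧
    ∑ i : Fin (n + 1), (Fin.snoc q t : Fin (n + 3) → ℝ) (e (Fin.castSucc (Fin.castSucc i))) = t + ∑ i ∈ Finset.univ.erase k, q (Fin.castSucc i) := by
  subst he
  have h1 : ∀ i : Fin (n + 1), i ≠ k → (Fin.snoc q t : Fin (n + 3) → ℝ) (Equiv.swap (Fin.castSucc (Fin.castSucc k) : Fin (n + 3))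
      (Fin.last (n + 2)) (Fin.castSucc (Fin.castSucc i))) = q (Fin.castSucc i) := fun i hi => by rw [swap_cc hi, Fin.snoc_castSucc]
  have h2 : (Fin.snoc q t : Fin (n + 3) → ℝ) (Equiv.swap (Fin.castSucc (Fin.castSucc k) : Fin (n + 3)) (Fin.last (n + 2))
      (Fin.castSucc (Fin.castSucc k))) = t := by rw [Equiv.swap_apply_left, Fin.snoc_last]
  refine ⟨h1, h2, by rw [swap_yy, Fin.snoc_castSucc], by rw [Equiv.swap_apply_right, Fin.snoc_castSucc], ?_⟩
  rw [sum_eq_add_sum_erase k, h2]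
  exact congrArg _ (Finset.sum_congr rfl fun i hi => h1 i (Finset.ne_of_mem_erase hi))

include he in
/-- Moving along the fibre is updating the `θ_k`-coordinate: `(snoc q a) ∘ e = update ((snoc q s) ∘ e) θ_k a`. [folklore] -/
theorem pt_eq_update (q : Fin (n + 2) → ℝ) (s a : ℝ) : (fun i => (Fin.snoc q a : Fin (n + 3) → ℝ) (e i)) =
    Function.update (fun i => (Fin.snoc q s : Fin (n + 3) → ℝ) (e i)) (Fin.castSucc (Fin.castSucc k)) a := by
  subst he
  ext i
  by_cases hi : i = Fin.castSucc (Fin.castSucc k)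
  · subst hi
    rw [Function.update_self, Equiv.swap_apply_left, Fin.snoc_last]
  · rw [Function.update_of_ne hi]
    have hne : Equiv.swap (Fin.castSucc (Fin.castSucc k) : Fin (n + 3)) (Fin.last (n + 2)) i ≠ Fin.last (n + 2) := fun h => hi (by
      have := congrArg (Equiv.swap (Fin.castSucc (Fin.castSucc k) : Fin (n + 3)) (Fin.last (n + 2))) h
      rwa [Equiv.swap_apply_self, Equiv.swap_apply_right] at this)
    rw [← Fin.castSucc_castPred _ hne, Fin.snoc_castSucc, Fin.snoc_castSucc]

include hB in
/-- The base `B = {(θ_{i≠k}, v, y)}` of the `θ_k`-band (coordinates `q = init z` of the permuted space: `q_i = θ_i` for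
`i ≠ k`, `q_k = v`, `q_last = y`) is `ℚ`-semialgebraic. [folklore] -/
theorem isSemialgebraic_base : IsSemialgebraic ℚ B := by
  subst hB
  have hA := IsSemialgebraic.biInter (Finset.univ.erase k) _ fun (i : Fin (n + 1)) _ =>
    isSemialgebraic_setOf_eval_pos (k := ℚ) (R := ℝ) (X (Fin.castSucc i) : MvPolynomial (Fin (n + 2)) ℚ)
  have hB := isSemialgebraic_setOf_eval_lt (k := ℚ) (R := ℝ) (∑ i ∈ Finset.univ.erase k, X (Fin.castSucc i) : MvPolynomial (Fin (n + 2)) ℚ) 1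
  have hC := isSemialgebraic_setOf_eval_pos (k := ℚ) (R := ℝ) (X (Fin.last (n + 1)) : MvPolynomial (Fin (n + 2)) ℚ)
  have hD := isSemialgebraic_setOf_eval_lt (k := ℚ) (R := ℝ)
    (X (Fin.last (n + 1)) * (1 - ∑ i ∈ Finset.univ.erase k, X (Fin.castSucc i)) : MvPolynomial (Fin (n + 2)) ℚ) 2
  have hE := IsSemialgebraic.biInter (Finset.univ.erase k) _ fun (i : Fin (n + 1)) _ =>
    isSemialgebraic_setOf_eval_lt (k := ℚ) (R := ℝ) (X (Fin.last (n + 1)) * X (Fin.castSucc i) : MvPolynomial (Fin (n + 2)) ℚ) 1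
  have hF := isSemialgebraic_setOf_eval_pos (k := ℚ) (R := ℝ) (X (Fin.castSucc k) : MvPolynomial (Fin (n + 2)) ℚ)
  have hG := isSemialgebraic_setOf_eval_lt (k := ℚ) (R := ℝ) (X (Fin.castSucc k) : MvPolynomial (Fin (n + 2)) ℚ) 1
  convert (((((hA.inter hB).inter hC).inter hD).inter hE).inter hF).inter hG using 1
  ext u
  simp only [map_sum, map_sub, map_mul, map_one, map_ofNat, MvPolynomial.aeval_X, mem_setOf_eq, mem_inter_iff, mem_iInter,
    Finset.mem_erase, Finset.mem_univ, and_true]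
  tauto

include ha hb in
/-- The ends `a = max 0 (1 − Σ_{i≠k}θ_i − 1/y)`, `b = min (1 − Σ_{i≠k}θ_i) (1/y)` of the `θ_k`-fibres are `ℚ`-semialgebraic
on any `ℚ`-semialgebraic base (`max`/`min` through `|·|`). [folklore] -/
theorem isSemialgebraicFunOn_ends (hBsa : IsSemialgebraic ℚ B) : IsSemialgebraicFunOn ℚ B a ∧ IsSemialgebraicFunOn ℚ B b := by
  have h1 : IsSemialgebraicFunOn ℚ B (fun _ : Fin (n + 2) → ℝ => (1:ℝ)) := isSemialgebraicFunOn_const_of_isAlgebraic hBsa isAlgebraic_one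
  have hh : IsSemialgebraicFunOn ℚ B (fun _ : Fin (n + 2) → ℝ => ((1/2 : ℚ) : ℝ)) := isSemialgebraicFunOn_ratCast hBsa _
  have hS : IsSemialgebraicFunOn ℚ B (fun q : Fin (n + 2) → ℝ => ∑ i ∈ Finset.univ.erase k, q (Fin.castSucc i)) :=
    IsSemialgebraicFunOn.fun_finsetSum (Finset.univ.erase k) hBsa (F := fun (i : Fin (n + 1)) (q : Fin (n + 2) → ℝ) => q (Fin.castSucc i))
      fun i _ => isSemialgebraicFunOn_apply hBsa _
  have hp : IsSemialgebraicFunOn ℚ B (fun q : Fin (n + 2) → ℝ => 1 - ∑ i ∈ Finset.univ.erase k, q (Fin.castSucc i)) := h1.fun_sub hS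
  have hr : IsSemialgebraicFunOn ℚ B (fun q : Fin (n + 2) → ℝ => (q (Fin.last (n + 1)))⁻¹) := (isSemialgebraicFunOn_apply hBsa _).fun_inv
  have hg := hp.fun_sub hr
  constructor
  · refine (hh.fun_mul (hg.fun_add hg.abs)).congr fun q _ => ?_
    beta_reduce
    rw [ha]
    rcases le_total 0 (1 - ∑ i ∈ Finset.univ.erase k, q (Fin.castSucc i) - (q (Fin.last (n + 1)))⁻¹) with h | h
    · rw [max_eq_right h, abs_of_nonneg h]; push_cast; ring
    · rw [max_eq_left h, abs_of_nonpos h]; push_cast; ring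
  · refine (hh.fun_mul ((hp.fun_add hr).fun_sub (hp.fun_sub hr).abs)).congr fun q _ => ?_
    beta_reduce
    rw [hb]
    rcases le_total (1 - ∑ i ∈ Finset.univ.erase k, q (Fin.castSucc i)) (q (Fin.last (n + 1)))⁻¹ with h | h
    · rw [min_eq_left h, abs_of_nonpos (by linarith)]; push_cast; ring
    · rw [min_eq_right h, abs_of_nonneg (by linarith)]; push_cast; ring

include hB ha hb in
/-- On the base, `a ≤ b` (because `y(1 − Σ_{i≠k}θ_i) < 2`). [folklore] -/
theorem ends_le {q : Fin (n + 2) → ℝ} (hq : q ∈ B) : a q ≤ b q := by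
  subst hB
  obtain ⟨-, hsum, hy, h2, -, -, -⟩ := hq
  rw [ha, hb]
  have hr : q (Fin.last (n + 1)) * (q (Fin.last (n + 1)))⁻¹ = 1 := mul_inv_cancel₀ hy.ne'
  have hr0 : 0 < (q (Fin.last (n + 1)))⁻¹ := inv_pos.mpr hy
  refine max_le (le_min (by linarith) hr0.le) (le_min (by linarith) ?_)
  by_contra h; push Not at h; nlinarith [mul_lt_mul_of_pos_left h hy]

include hWo in
/-- The open chart domain fibred over `(θ_{i≠k}, y, v)`: `w ∈ W` iff the base conditions hold and
`max 0 (1 − Σ_{i≠k}θ_i − 1/y) < θ_k < min (1 − Σ_{i≠k}θ_i) (1/y)`. [folklore] -/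
theorem mem_open_iff (w : Fin (n + 3) → ℝ) : w ∈ Wo ↔
    ((∀ i : Fin (n + 1), i ≠ k → 0 < w (Fin.castSucc (Fin.castSucc i))) ∧ ∑ i ∈ Finset.univ.erase k, w (Fin.castSucc (Fin.castSucc i)) < 1 ∧ 0 < w (Fin.castSucc (Fin.last (n + 1))) ∧ w (Fin.castSucc (Fin.last (n + 1))) * (1 - ∑ i ∈ Finset.univ.erase k, w (Fin.castSucc (Fin.castSucc i))) < 2 ∧ (∀ i : Fin (n + 1), i ≠ k → w (Fin.castSucc (Fin.last (n + 1))) * w (Fin.castSucc (Fin.castSucc i)) < 1) ∧ 0 < w (Fin.last (n + 2)) ∧ w (Fin.last (n + 2)) < 1) ∧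
    max 0 (1 - ∑ i ∈ Finset.univ.erase k, w (Fin.castSucc (Fin.castSucc i)) - (w (Fin.castSucc (Fin.last (n + 1))))⁻¹) < w (Fin.castSucc (Fin.castSucc k)) ∧
    w (Fin.castSucc (Fin.castSucc k)) < min (1 - ∑ i ∈ Finset.univ.erase k, w (Fin.castSucc (Fin.castSucc i))) (w (Fin.castSucc (Fin.last (n + 1))))⁻¹ := by
  subst hWo
  simp only [mem_setOf_eq, Fin.init, max_lt_iff, lt_min_iff]
  rw [sum_eq_add_sum_erase k]
  constructor
  · rintro ⟨⟨hpos, hsum, hy, h0, hi⟩, hv0, hv1⟩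
    have hr : w (Fin.castSucc (Fin.last (n + 1))) * (w (Fin.castSucc (Fin.last (n + 1))))⁻¹ = 1 := mul_inv_cancel₀ hy.ne'
    have hr0 : 0 < (w (Fin.castSucc (Fin.last (n + 1))))⁻¹ := inv_pos.mpr hy
    have hk := hi k
    have hpk := hpos k
    refine ⟨⟨fun i _ => hpos i, by linarith, hy, by nlinarith, fun i _ => hi i, hv0, hv1⟩, ⟨hpk, ?_⟩, by linarith, ?_⟩
    · by_contra h; push Not at h; nlinarith [mul_le_mul_of_nonneg_left h hy.le]
    · by_contra h; push Not at h; nlinarith [mul_le_mul_of_nonneg_left h hy.le]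
  · rintro ⟨⟨hpos, hsum, hy, h2, hi, hv0, hv1⟩, ⟨h0, ha⟩, hb, hb'⟩
    have hr : w (Fin.castSucc (Fin.last (n + 1))) * (w (Fin.castSucc (Fin.last (n + 1))))⁻¹ = 1 := mul_inv_cancel₀ hy.ne'
    refine ⟨⟨fun i => ?_, by linarith, hy, by nlinarith [mul_lt_mul_of_pos_left ha hy], fun i => ?_⟩, hv0, hv1⟩
    · by_cases hik : i = k
      · rw [hik]; exact h0
      · exact hpos i hik
    · by_cases hik : i = k
      · rw [hik]; nlinarith [mul_lt_mul_of_pos_left hb' hy]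
      · exact hi i hik

include hWc in
/-- The closed band fibred over `(θ_{i≠k}, y, v)`: `w ∈ Wc` iff the base conditions hold and
`max 0 (1 − Σ_{i≠k}θ_i − 1/y) ≤ θ_k ≤ min (1 − Σ_{i≠k}θ_i) (1/y)`. [folklore] -/
theorem mem_closed_iff (w : Fin (n + 3) → ℝ) : w ∈ Wc ↔
    ((∀ i : Fin (n + 1), i ≠ k → 0 < w (Fin.castSucc (Fin.castSucc i))) ∧ ∑ i ∈ Finset.univ.erase k, w (Fin.castSucc (Fin.castSucc i)) < 1 ∧ 0 < w (Fin.castSucc (Fin.last (n + 1))) ∧ w (Fin.castSucc (Fin.last (n + 1))) * (1 - ∑ i ∈ Finset.univ.erase k, w (Fin.castSucc (Fin.castSucc i))) < 2 ∧ (∀ i : Fin (n + 1), i ≠ k → w (Fin.castSucc (Fin.last (n + 1))) * w (Fin.castSucc (Fin.castSucc i)) < 1) ∧ 0 < w (Fin.last (n + 2)) ∧ w (Fin.last (n + 2)) < 1) ∧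
    max 0 (1 - ∑ i ∈ Finset.univ.erase k, w (Fin.castSucc (Fin.castSucc i)) - (w (Fin.castSucc (Fin.last (n + 1))))⁻¹) ≤ w (Fin.castSucc (Fin.castSucc k)) ∧
    w (Fin.castSucc (Fin.castSucc k)) ≤ min (1 - ∑ i ∈ Finset.univ.erase k, w (Fin.castSucc (Fin.castSucc i))) (w (Fin.castSucc (Fin.last (n + 1))))⁻¹ := by
  subst hWc
  simp only [mem_setOf_eq, max_le_iff, le_min_iff]
  rw [sum_eq_add_sum_erase k]
  constructor
  · rintro ⟨hpos, hsum, hy, h2, hi, hv0, hv1, h0, hs1, hys, hyk⟩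
    have hr : w (Fin.castSucc (Fin.last (n + 1))) * (w (Fin.castSucc (Fin.last (n + 1))))⁻¹ = 1 := mul_inv_cancel₀ hy.ne'
    have hr0 : 0 < (w (Fin.castSucc (Fin.last (n + 1))))⁻¹ := inv_pos.mpr hy
    refine ⟨⟨hpos, hsum, hy, h2, hi, hv0, hv1⟩, ⟨h0, ?_⟩, by linarith, ?_⟩
    · by_contra h; push Not at h; nlinarith [mul_lt_mul_of_pos_left h hy]
    · by_contra h; push Not at h; nlinarith [mul_lt_mul_of_pos_left h hy]
  · rintro ⟨⟨hpos, hsum, hy, h2, hi, hv0, hv1⟩, ⟨h0, ha⟩, hb, hb'⟩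
    have hr : w (Fin.castSucc (Fin.last (n + 1))) * (w (Fin.castSucc (Fin.last (n + 1))))⁻¹ = 1 := mul_inv_cancel₀ hy.ne'
    exact ⟨hpos, hsum, hy, h2, hi, hv0, hv1, h0, by linarith, by nlinarith [mul_le_mul_of_nonneg_left ha hy.le],
      by nlinarith [mul_le_mul_of_nonneg_left hb' hy.le]⟩

include he hB ha hb hWc in
/-- The closed band read through the transposition: `z ∈ band B a b ↔ z ∘ e ∈ Wc`. [folklore] -/
theorem mem_band_iff (z : Fin (n + 3) → ℝ) : z ∈ KZlog.band B a b ↔ (fun i => z (e i)) ∈ Wc := by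
  rw [KZlog.mem_band, ha, hb, mem_closed_iff hWc]
  subst he hB
  simp +contextual only [mem_setOf_eq, Fin.init, ne_eq, not_false_eq_true, swap_cc, swap_yy, Equiv.swap_apply_left,
    Equiv.swap_apply_right, sum_erase_swap]

include he hB ha hb hWo in
/-- The open band read through the transposition: `z ∈ {a < z_last < b} ↔ z ∘ e ∈ W`. [folklore] -/
theorem mem_openBand_iff (z : Fin (n + 3) → ℝ) :
    z ∈ {z : Fin (n + 3) → ℝ | Fin.init z ∈ B ∧ a (Fin.init z) < z (Fin.last (n + 2)) ∧ z (Fin.last (n + 2)) < b (Fin.init z)} ↔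
      (fun i => z (e i)) ∈ Wo := by
  rw [mem_open_iff (k := k) hWo]
  subst he hB
  simp +contextual only [mem_setOf_eq, Fin.init, ha, hb, ne_eq, not_false_eq_true, swap_cc, swap_yy, Equiv.swap_apply_left,
    Equiv.swap_apply_right, sum_erase_swap]

include he hB ha hb hWc in
/-- **The primitive vanishes at both ends of every closed `θ_k`-fibre**: at `θ_k = a` one has `θ_k = 0` or
`y(1 − Σθ) = 1`, at `θ_k = b` one has `Σθ = 1` or `yθ_k = 1`. [folklore] -/
theorem c_ends {c : (Fin (n + 3) → ℝ) → ℝ}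
    (hends : ∀ w ∈ Wc, (w (Fin.castSucc (Fin.castSucc k)) = 0 ∨ ∑ i : Fin (n + 1), w (Fin.castSucc (Fin.castSucc i)) = 1 ∨
      w (Fin.castSucc (Fin.last (n + 1))) * (1 - ∑ i : Fin (n + 1), w (Fin.castSucc (Fin.castSucc i))) = 1 ∨
      w (Fin.castSucc (Fin.last (n + 1))) * w (Fin.castSucc (Fin.castSucc k)) = 1) → c w = 0)
    {q : Fin (n + 2) → ℝ} (hq : q ∈ B) (hab : a q ≤ b q) :
    c (fun i => (Fin.snoc q (b q) : Fin (n + 3) → ℝ) (e i)) - c (fun i => (Fin.snoc q (a q) : Fin (n + 3) → ℝ) (e i)) = 0 := by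
  have hy : 0 < q (Fin.last (n + 1)) := by rw [hB] at hq; exact hq.2.2.1
  have hr : q (Fin.last (n + 1)) * (q (Fin.last (n + 1)))⁻¹ = 1 := mul_inv_cancel₀ hy.ne'
  have hzero : ∀ t ∈ Icc (a q) (b q), (t = 0 ∨ t + ∑ i ∈ Finset.univ.erase k, q (Fin.castSucc i) = 1 ∨
      q (Fin.last (n + 1)) * (1 - (t + ∑ i ∈ Finset.univ.erase k, q (Fin.castSucc i))) = 1 ∨ q (Fin.last (n + 1)) * t = 1) →
      c (fun i => (Fin.snoc q t : Fin (n + 3) → ℝ) (e i)) = 0 := by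
    intro t ht hor
    refine hends _ ((mem_band_iff he hB ha hb hWc _).mp (KZlog.snoc_mem_band.mpr ⟨hq, ht⟩)) ?_
    obtain ⟨-, h2, h3, -, h5⟩ := pt_apply he q t
    simpa only [h2, h3, h5] using hor
  have hbq : c (fun i => (Fin.snoc q (b q) : Fin (n + 3) → ℝ) (e i)) = 0 := by
    refine hzero _ ⟨hab, le_rfl⟩ ?_
    rw [hb]
    rcases le_total (1 - ∑ i ∈ Finset.univ.erase k, q (Fin.castSucc i)) (q (Fin.last (n + 1)))⁻¹ with h | h
    · exact Or.inr (Or.inl (by rw [min_eq_left h]; ring))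
    · exact Or.inr (Or.inr (Or.inr (by rw [min_eq_right h, hr])))
  have haq : c (fun i => (Fin.snoc q (a q) : Fin (n + 3) → ℝ) (e i)) = 0 := by
    refine hzero _ ⟨le_rfl, hab⟩ ?_
    rw [ha]
    rcases le_total (1 - ∑ i ∈ Finset.univ.erase k, q (Fin.castSucc i) - (q (Fin.last (n + 1)))⁻¹) 0 with h | h
    · exact Or.inl (max_eq_left h)
    · refine Or.inr (Or.inr (Or.inl ?_))
      rw [max_eq_right h, show 1 - (1 - ∑ i ∈ Finset.univ.erase k, q (Fin.castSucc i) - (q (Fin.last (n + 1)))⁻¹ +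
        ∑ i ∈ Finset.univ.erase k, q (Fin.castSucc i)) = (q (Fin.last (n + 1)))⁻¹ by ring, hr]
  rw [hbq, haq, sub_zero]

end CornerThetaGeo

/-- **Geometry of the lateral Newton–Leibniz moves of the corner Stokes in general dimension** (registered stub
`cornerThetaGeoGen`): for an ABSTRACT primitive `c` (semialgebraic on the closed `θ_k`-band `Wc`, continuous on the
closed `θ_k`-fibres, vanishing at their ends) with bounded semialgebraic slice derivative `d` on the open chart domain
`Wo`, the representation `N = [Wo, d]` exists and `[N] ∈ KZ.relations`: transpose `θ_k ↔ v` so that `θ_k` is the last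
coordinate, apply rule 3 on the band `{a ≤ θ_k ≤ b}` over the base `B = {(θ_{i≠k}, v, y)}` (boundary term `0 − 0`),
open the fibres and permute the coordinates back. [cite: KontsevichZagier2001, §1.2 rule (3)] -/
theorem cornerThetaGeoGen : ∀ (n : ℕ) (k : Fin (n + 1)) (c d : (Fin (n + 3) → ℝ) → ℝ) (C : ℝ) (Wc Wo : Set (Fin (n + 3) → ℝ)),
    Wc = {w : Fin (n + 3) → ℝ | (∀ i : Fin (n + 1), i ≠ k → 0 < w (Fin.castSucc (Fin.castSucc i))) ∧ ∑ i ∈ Finset.univ.erase k, w (Fin.castSucc (Fin.castSucc i)) < 1 ∧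
      0 < w (Fin.castSucc (Fin.last (n + 1))) ∧ w (Fin.castSucc (Fin.last (n + 1))) * (1 - ∑ i ∈ Finset.univ.erase k, w (Fin.castSucc (Fin.castSucc i))) < 2 ∧
      (∀ i : Fin (n + 1), i ≠ k → w (Fin.castSucc (Fin.last (n + 1))) * w (Fin.castSucc (Fin.castSucc i)) < 1) ∧ 0 < w (Fin.last (n + 2)) ∧ w (Fin.last (n + 2)) < 1 ∧
      0 ≤ w (Fin.castSucc (Fin.castSucc k)) ∧ ∑ i : Fin (n + 1), w (Fin.castSucc (Fin.castSucc i)) ≤ 1 ∧ w (Fin.castSucc (Fin.last (n + 1))) * (1 - ∑ i : Fin (n + 1), w (Fin.castSucc (Fin.castSucc i))) ≤ 1 ∧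
      w (Fin.castSucc (Fin.last (n + 1))) * w (Fin.castSucc (Fin.castSucc k)) ≤ 1} →
    Wo = {w : Fin (n + 3) → ℝ | (Fin.init w : Fin (n + 2) → ℝ) ∈ {u : Fin (n + 2) → ℝ | (∀ i : Fin (n + 1), 0 < u (Fin.castSucc i)) ∧ ∑ i : Fin (n + 1), u (Fin.castSucc i) < 1 ∧ 0 < u (Fin.last (n + 1)) ∧ u (Fin.last (n + 1)) * (1 - ∑ i : Fin (n + 1), u (Fin.castSucc i)) < 1 ∧ ∀ i : Fin (n + 1), u (Fin.last (n + 1)) * u (Fin.castSucc i) < 1} ∧ 0 < w (Fin.last (n + 2)) ∧ w (Fin.last (n + 2)) < 1} →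
    IsSemialgebraicFunOn ℚ Wc c →
    (∀ w ∈ Wc, ContinuousOn (fun a => c (Function.update w (Fin.castSucc (Fin.castSucc k) : Fin (n + 3)) a)) {a | Function.update w (Fin.castSucc (Fin.castSucc k) : Fin (n + 3)) a ∈ Wc}) →
    (∀ w ∈ Wc, (w (Fin.castSucc (Fin.castSucc k)) = 0 ∨ ∑ i : Fin (n + 1), w (Fin.castSucc (Fin.castSucc i)) = 1 ∨
      w (Fin.castSucc (Fin.last (n + 1))) * (1 - ∑ i : Fin (n + 1), w (Fin.castSucc (Fin.castSucc i))) = 1 ∨ w (Fin.castSucc (Fin.last (n + 1))) * w (Fin.castSucc (Fin.castSucc k)) = 1) → c w = 0) →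
    IsSemialgebraicFunOn ℚ Wo d → (∀ w ∈ Wo, |d w| ≤ C) →
    (∀ w ∈ Wo, HasDerivAt (fun a => c (Function.update w (Fin.castSucc (Fin.castSucc k) : Fin (n + 3)) a)) (d w) (w (Fin.castSucc (Fin.castSucc k) : Fin (n + 3)))) →
    ∃ N : KZ.IntegralRep (n + 3), N.domain = Wo ∧ Set.EqOn N.integrand d N.domain ∧ KZ.of N ∈ KZ.relations := by
  intro n k c d C Wc Wo hWc hWo hc hcont hends hd hC hder
  -- the transposition, the base, the ends of the fibres, the band
  obtain ⟨e, he⟩ : ∃ e : Equiv.Perm (Fin (n + 3)), e = Equiv.swap (Fin.castSucc (Fin.castSucc k)) (Fin.last (n + 2)) := ⟨_, rfl⟩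
  obtain ⟨B, hB⟩ : ∃ B : Set (Fin (n + 2) → ℝ), B = {q : Fin (n + 2) → ℝ | (∀ i : Fin (n + 1), i ≠ k → 0 < q (Fin.castSucc i)) ∧ ∑ i ∈ Finset.univ.erase k, q (Fin.castSucc i) < 1 ∧ 0 < q (Fin.last (n + 1)) ∧ q (Fin.last (n + 1)) * (1 - ∑ i ∈ Finset.univ.erase k, q (Fin.castSucc i)) < 2 ∧ (∀ i : Fin (n + 1), i ≠ k → q (Fin.last (n + 1)) * q (Fin.castSucc i) < 1) ∧ 0 < q (Fin.castSucc k) ∧ q (Fin.castSucc k) < 1} := ⟨_, rfl⟩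
  obtain ⟨a, ha⟩ : ∃ a : (Fin (n + 2) → ℝ) → ℝ, ∀ q, a q = max 0 (1 - ∑ i ∈ Finset.univ.erase k, q (Fin.castSucc i) - (q (Fin.last (n + 1)))⁻¹) :=
    ⟨fun q => max 0 (1 - ∑ i ∈ Finset.univ.erase k, q (Fin.castSucc i) - (q (Fin.last (n + 1)))⁻¹), fun q => rfl⟩
  obtain ⟨b, hb⟩ : ∃ b : (Fin (n + 2) → ℝ) → ℝ, ∀ q, b q = min (1 - ∑ i ∈ Finset.univ.erase k, q (Fin.castSucc i)) (q (Fin.last (n + 1)))⁻¹ :=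
    ⟨fun q => min (1 - ∑ i ∈ Finset.univ.erase k, q (Fin.castSucc i)) (q (Fin.last (n + 1)))⁻¹, fun q => rfl⟩
  have hBsa : IsSemialgebraic ℚ B := CornerThetaGeo.isSemialgebraic_base hB
  obtain ⟨hasa, hbsa⟩ := CornerThetaGeo.isSemialgebraicFunOn_ends ha hb hBsa
  have hab : ∀ q ∈ B, a q ≤ b q := fun q hq => CornerThetaGeo.ends_le hB ha hb hq
  have hBdsa : IsSemialgebraic ℚ (KZlog.band B a b) := KZlog.isSemialgebraic_band hasa hbsa
  have hBdmeas : MeasurableSet (KZlog.band B a b) := Literature.ModelTheory.ExponentialFields.IsSemialgebraic.measurableSet_holds hBdsa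
  -- membership through the transposition; `Wz` = the band with open fibres = `W` read through `e`
  have hee : ∀ j, e (e j) = j := fun j => by rw [he]; exact Equiv.swap_apply_self _ _ _
  have hcomp : ∀ z : Fin (n + 3) → ℝ, (fun j => z (e (e j))) = z := fun z => funext fun j => by rw [hee]
  have hmemc : ∀ z : Fin (n + 3) → ℝ, z ∈ KZlog.band B a b ↔ (fun i => z (e i)) ∈ Wc := CornerThetaGeo.mem_band_iff he hB ha hb hWc
  set Wz : Set (Fin (n + 3) → ℝ) := {z | Fin.init z ∈ B ∧ a (Fin.init z) < z (Fin.last (n + 2)) ∧ z (Fin.last (n + 2)) < b (Fin.init z)} with hWz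
  have hmemo : ∀ z : Fin (n + 3) → ℝ, z ∈ Wz ↔ (fun i => z (e i)) ∈ Wo := CornerThetaGeo.mem_openBand_iff he hB ha hb hWo
  have hmemo' : ∀ w : Fin (n + 3) → ℝ, (fun i => w (e i)) ∈ Wz ↔ w ∈ Wo := fun w => by simpa only [hcomp w] using hmemo (fun i => w (e i))
  have hWzsa : IsSemialgebraic ℚ Wz := by
    convert hasa.isSemialgebraic_setOf_gt.inter hbsa.isSemialgebraic_setOf_lt using 1
    ext z; simp only [hWz, mem_setOf_eq, mem_inter_iff]; tauto
  have hWzBd : Wz ⊆ KZlog.band B a b := fun z hz => ⟨hz.1, hz.2.1.le, hz.2.2.le⟩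
  -- the transported functions `F = c ∘ (· ∘ e)` and `f = 𝟙_{Wz} · d ∘ (· ∘ e)`
  set F : (Fin (n + 3) → ℝ) → ℝ := fun z => c (fun i => z (e i)) with hF
  set f : (Fin (n + 3) → ℝ) → ℝ := Wz.indicator fun z => d (fun i => z (e i)) with hf
  have hωmap : ∀ {T : Set (Fin (n + 3) → ℝ)}, IsSemialgebraic ℚ T → IsSemialgebraicMapOn ℚ T (fun z : Fin (n + 3) → ℝ => fun i => z (e i)) :=
    fun hT => IsSemialgebraicMapOn.of_forall hT fun j => isSemialgebraicFunOn_apply hT (e j)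
  have hFsa : IsSemialgebraicFunOn ℚ (KZlog.band B a b) F :=
    IsSemialgebraicFunOn.comp_isSemialgebraicMapOn_holds hc (hωmap hBdsa) fun z hz => (hmemc z).mp hz
  have hfsa : IsSemialgebraicFunOn ℚ (KZlog.band B a b) f := by
    have h1 : IsSemialgebraicFunOn ℚ Wz (fun z => d (fun i => z (e i))) :=
      IsSemialgebraicFunOn.comp_isSemialgebraicMapOn_holds hd (hωmap hWzsa) fun z hz => (hmemo z).mp hz
    have h2 : IsSemialgebraicFunOn ℚ (KZlog.band B a b \ Wz) (fun _ => (0:ℝ)) := by simpa using isSemialgebraicFunOn_ratCast (hBdsa.diff hWzsa) 0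
    have h := IsSemialgebraicFunOn.union (F := f) h1 h2 (fun z hz => indicator_of_mem hz _) (fun z hz => indicator_of_notMem hz.2 _)
    rwa [union_sdiff_cancel hWzBd] at h
  -- fibrewise: continuity on the closed fibre, derivative on the open fibre
  have hpt : ∀ q ∈ B, ∀ t ∈ Icc (a q) (b q), (fun i => (Fin.snoc q t : Fin (n + 3) → ℝ) (e i)) ∈ Wc :=
    fun q hq t ht => (hmemc _).mp (KZlog.snoc_mem_band.mpr ⟨hq, ht⟩)
  have hcontF : ∀ q ∈ B, ContinuousOn (fun t : ℝ => F (Fin.snoc q t)) (Icc (a q) (b q)) := by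
    intro q hq
    have h := hcont _ (hpt q hq (a q) ⟨le_rfl, hab q hq⟩)
    have hset : {t : ℝ | Function.update (fun i => (Fin.snoc q (a q) : Fin (n + 3) → ℝ) (e i)) (Fin.castSucc (Fin.castSucc k)) t ∈ Wc} =
        Icc (a q) (b q) := by
      ext t
      rw [mem_setOf_eq, ← CornerThetaGeo.pt_eq_update he q (a q) t, ← hmemc (Fin.snoc q t), KZlog.snoc_mem_band]
      exact ⟨fun h' => h'.2, fun h' => ⟨hq, h'⟩⟩
    rw [hset] at h
    refine h.congr fun t _ => ?_
    show c _ = c _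
    rw [CornerThetaGeo.pt_eq_update he q (a q) t]
  have hderF : ∀ q ∈ B, ∀ t ∈ Ioo (a q) (b q), HasDerivAt (fun t : ℝ => F (Fin.snoc q t)) (f (Fin.snoc q t)) t := by
    intro q hq t ht
    have hz : (Fin.snoc q t : Fin (n + 3) → ℝ) ∈ Wz := by
      simp only [hWz, mem_setOf_eq, Fin.init_snoc, Fin.snoc_last]; exact ⟨hq, ht.1, ht.2⟩
    have h := hder _ ((hmemo _).mp hz)
    obtain ⟨-, h2, -⟩ := CornerThetaGeo.pt_apply he q t
    simp only [h2] at h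
    simp only [hF, hf, indicator_of_mem hz]
    refine h.congr_of_eventuallyEq (Filter.Eventually.of_forall fun s => ?_)
    show c _ = c _
    rw [CornerThetaGeo.pt_eq_update he q t s]
  -- `f` is bounded by `|C|` and supported in `Wz ⊆ [0, n+2]^(n+3)`, hence integrable on the band
  have hWzbox : Wz ⊆ Icc (0 : Fin (n + 3) → ℝ) (fun _ => (n:ℝ) + 2) := by
    intro z hz
    have hz' := (hmemo z).mp hz
    rw [hWo] at hz'
    obtain ⟨hu, hv0, hv1⟩ := hz'
    have hbox := CornerVGen.U_subset_Icc hu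
    have hv0' : 0 < z (e (Fin.last (n + 2))) := hv0
    have hv1' : z (e (Fin.last (n + 2))) < 1 := hv1
    have hn : (0:ℝ) ≤ n := n.cast_nonneg
    have hall : ∀ j, 0 ≤ z (e j) ∧ z (e j) ≤ (n:ℝ) + 2 := fun j =>
      Fin.lastCases ⟨hv0'.le, by linarith⟩ (fun j' => ⟨hbox.1 j', hbox.2 j'⟩) j
    exact ⟨fun j => by simpa only [hee, Pi.zero_apply] using (hall (e j)).1, fun j => by simpa only [hee] using (hall (e j)).2⟩
  have hint : IntegrableOn f (KZlog.band B a b) := by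
    refine IntegrableOn.of_forall_sdiff_eq_zero ?_ hBdmeas fun z hz => indicator_of_notMem hz.2 _
    refine ⟨(aestronglyMeasurable_of_isSemialgebraicFunOn hfsa hBdmeas).mono_set hWzBd,
      HasFiniteIntegral.restrict_of_bounded (C := |C|) ((measure_mono hWzbox).trans_lt measure_Icc_lt_top)
        (Filter.Eventually.of_forall fun z => ?_)⟩
    by_cases hz : z ∈ Wz
    · rw [Real.norm_eq_abs, hf, indicator_of_mem hz]; exact (hC _ ((hmemo z).mp hz)).trans (le_abs_self C)
    · rw [Real.norm_eq_abs, hf, indicator_of_notMem hz, abs_zero]; exact abs_nonneg C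
  -- the boundary term vanishes identically
  have hbdry : ∀ q ∈ B, F (Fin.snoc q (b q)) - F (Fin.snoc q (a q)) = 0 := fun q hq =>
    CornerThetaGeo.c_ends he hB ha hb hWc hends hq (hab q hq)
  have hds : IsSemialgebraicFunOn ℚ B (fun q => F (Fin.snoc q (b q)) - F (Fin.snoc q (a q))) :=
    (isSemialgebraicFunOn_ratCast hBsa 0).congr fun q hq => by push_cast; exact (hbdry q hq).symm
  have hdi : IntegrableOn (fun q => F (Fin.snoc q (b q)) - F (Fin.snoc q (a q))) B :=
    (integrableOn_zero).congr_fun (fun q hq => (hbdry q hq).symm) (Literature.ModelTheory.ExponentialFields.IsSemialgebraic.measurableSet_holds hBsa)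
  -- the move, the opening of the fibres, the permutation of the coordinates
  obtain ⟨rb, rd, hrbd, hrbi, hrdd, hrdi, hrel⟩ := KZ.exists_band_newtonLeibniz hBsa a b hasa hbsa hab F f hFsa hfsa hcontF hderF hint hds hdi
  obtain ⟨r', hr'd, hr'i, hr'rel⟩ := KZ.of_sub_of_restrict_openBand_mem_relations hasa hbsa rb hrbd
  have hrd0 : KZ.of rd ∈ KZ.relations :=
    KZ.of_mem_relations_of_eqOn_zero rd fun q hq => by rw [hrdi]; exact hbdry q (by rwa [hrdd] at hq)
  refine ⟨r'.reindex e, ?_, ?_, ?_⟩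
  · ext w
    rw [IntegralRep.reindex_domain, mem_setOf_eq, hr'd]
    exact hmemo' w
  · intro w hw
    rw [IntegralRep.reindex_domain, mem_setOf_eq, hr'd] at hw
    rw [IntegralRep.reindex_integrand, hr'i, hrbi]
    show f (fun i => w (e i)) = d w
    rw [hf, indicator_of_mem hw]
    show d (fun j => w (e (e j))) = d w
    rw [hcomp w]
  · have hre := KZ.of_sub_of_reindex_mem_relations r' e
    have : KZ.of (r'.reindex e) = (KZ.of rb - KZ.of rd) + KZ.of rd - (KZ.of rb - KZ.of r') - (KZ.of r' - KZ.of (r'.reindex e)) := by abel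
    rw [this]
    exact KZ.relations.sub_mem (KZ.relations.sub_mem (KZ.relations.add_mem hrel hrd0) hr'rel) hre

end Summit.KontsevichZagierPeriods.TerasomaMultiplication.MultiplicationAccessible

end
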